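/-
Copyright (c) 2026 the pub-hodgecm-mathlib formalisation cell (harness21).  Prover seat hodgecm-mathlib-K2E5-p16 (g6), Track B «K2-LIT»,
#184♮ = hLiu418 = `stmt-HodgeConjecture-24832`; A7-val ROAD (σ) «NULL-CONE MULTIPLICITY ONE», file V5b-gen PART 1 `K2LiuNullConeStratumPeeling`
(K2Liu-p09 (g6) organ-lead word 11:49:58Z «V5b-gen = the STRATIFIED twin of ★ V5 for the split place»): the ONE-STRATUM engine.
THEOREMS ONLY (no `def`, no `instance`, no notation, no named-fact hypothesis, no `sorry`).
-/
import Summits.HodgeConjecture.HodgeConjecture.Theorems.K2LiuHomogeneousFunctionalVanishing   -- ★ (this seat) V4b (imports ★ V4)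
import Literature.Topology.CompactOpenDisjointRefinement                                   -- ★ `isLocallyConstant_indicator_of_isClopen`, …
import Mathlib.Topology.Algebra.Group.OpenMapping
import Mathlib.Topology.Baire.LocallyCompactRegular
import Mathlib.LinearAlgebra.Basis.VectorSpace
import HarnessLib

/-!
# Crux `HLiu418`, A7-val road (σ), V5b-gen part 1: peeling ONE stratum of the null cone

Cell `hodgecm-mathlib`, crux item hLiu418 = `stmt-HodgeConjecture-24832` (helper lane `--supports`, count-neutral).

★ V5 (`K2LiuNullConeMultiplicityOne`, K2Liu-p09) treats a null cone `N` whose complement of the vertex is ONE orbit.  At a SPLIT place the null cone is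
STRATIFIED (★ V3 (O2) `K2LiuNullConeOrbitsSplit`, K2Liu-p14): a chain of closed `Γ`-stable sets `∅ = N₀ ⊆ N₁ ⊆ … ⊆ N_r = N` whose strata `N_{i+1} ∖ N_i` are single
orbits, all but one carrying a relatively invariant measure of the WRONG character.  This file is the one-stratum engine; part 2
`K2LiuNullConeMultiplicityOneStratified` iterates it along the chain.
SETTING (★ V5's ambient: `Γ` t.d. σ-compact topological group, `K₀` compact open, `χ : Γ →* ℂ` trivial on `K₀`; `X` a Hausdorff locally compact `Γ`-space):
a pair of closed `Γ`-stable sets `M′ ⊆ M` with `M ∖ M′` ONE `Γ`-orbit and the EXTENSION property «every lcc function on `M ∖ M′` is `F|_{M∖M′}` for an lcc `F`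
vanishing on `M′`»; functionals `T : (X → ℂ) →ₗ ℂ` `χ`-semi-invariant (`T (F ∘ (γ • ·)) = χ γ · T F`) on the lcc `F` vanishing on `M′` and killing the lcc `F`
vanishing on `M` (★ V5's (N′)-currency; for locally constant `F`, «`= 0` on `M′`» ⇔ «`= 0` near `M′`»).
* §1 `lcc_restrict_sdiff`, `apply_eq_of_agree_on_sdiff` — restriction to the stratum; `T F` depends only on `F|_{M∖M′}`;
* §2 `exists_descend`, `descend_semiInvariant` — the descended functional on the test functions of the stratum and its semi-invariance
  (stated with an abstract action map `act`, so that no subtype action enters a statement);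
* §3 **`kills_of_wrongChar_stratum`** — PEELING: a wrong-character witness on the stratum (`x₀ ∈ M ∖ M′`, `γ₀ • x₀ = x₀`, a reference functional `T′`,
  `χ′`-semi-invariant on the lcc `F` vanishing on `M′`, killing those vanishing on `M`, non-degenerate, `χ γ₀ ≠ χ′ γ₀`) forces «`T` kills lcc vanishing on `M`»
  ⇒ «`T` kills lcc vanishing on `M′`» (★ V4b `apply_base_eq_zero_of_char_ne` + ★ V4 `eq_zero_of_apply_base_eq_zero` on the orbit, open orbit maps by
  `isOpenMap_smul_of_sigmaCompact`); **`exists_const_of_line_stratum`** — on the LINE stratum two such functionals become proportional on the lcc `F`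
  vanishing on `M′` (★ V4 `exists_forall_apply_eq_const_mul`).
References: [BernsteinZelevinsky1976, §1.5, §1.18]; [Rallis1984]; [KudlaRallis1990, §2–3]; [KudlaSweet1997, §§2–4].
HONEST LABEL: HC_CM is proved only modulo the 7 printed citations (2 remaining named inputs: hLiu418 = stmt-HodgeConjecture-24832,
h413 = stmt-HodgeConjecture-24833) until rung 0 closes; count-neutral helper, closes no socket.
-/

set_option autoImplicit false
set_option linter.dupNamespace false

noncomputable section

open Set Filter Topology MulAction Literature.Topology
open scoped Pointwise
open Summit.HodgeConjecture.HodgeConjecture.Cruxes.HLiu418.K2LiuHomogeneousFunctionalLine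
open Summit.HodgeConjecture.HodgeConjecture.Cruxes.HLiu418.K2LiuHomogeneousFunctionalVanishing

namespace Summit.HodgeConjecture.HodgeConjecture.Cruxes.HLiu418.K2LiuNullConeStratumPeeling

/-! ## §1  Restriction to a stratum; `T F` depends only on `F|_{M ∖ M′}` -/

section Restrict

variable {X : Type*} [TopologicalSpace X]

/-- A locally constant function vanishing ON a set vanishes NEAR every point of it. [BernsteinZelevinsky1976, §1.1] -/
theorem eventually_eq_zero_of_apply_eq_zero {F : X → ℂ} (hF : IsLocallyConstant F) {x : X} (hx : F x = 0) : ∀ᶠ y in 𝓝 x, F y = 0 := by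
  simpa only [hx] using hF.eventually_eq x

/-- **Restriction to the stratum**: for `M` closed, an lcc `F` on `X` vanishing on `M′` restricts to an lcc function on `M ∖ M′`.
[BernsteinZelevinsky1976, §1.3] -/
theorem lcc_restrict_sdiff {M M' : Set X} (hM : IsClosed M) {F : X → ℂ} (hF : IsLocallyConstant F) (hFs : HasCompactSupport F)
    (hF0 : ∀ x ∈ M', F x = 0) :
    IsLocallyConstant (fun z : ↥(M \ M') => F z) ∧ HasCompactSupport (fun z : ↥(M \ M') => F z) := by
  refine ⟨hF.comp_continuous continuous_subtype_val, ?_⟩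
  have hM' : ∀ x ∈ M', x ∉ tsupport F := fun x hx =>
    notMem_tsupport_iff_eventuallyEq.2 (eventually_eq_zero_of_apply_eq_zero hF (hF0 x hx))
  have hK : IsCompact ((Subtype.val : ↥(M \ M') → X) ⁻¹' tsupport F) := by
    refine Subtype.isCompact_iff.2 ?_
    rw [Set.image_preimage_eq_inter_range, Subtype.range_coe]
    have hset : tsupport F ∩ (M \ M') = tsupport F ∩ M := by
      ext x
      exact ⟨fun hx => ⟨hx.1, hx.2.1⟩, fun hx => ⟨hx.1, hx.2, fun hxM' => hM' x hxM' hx.1⟩⟩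
    rw [hset]
    exact hFs.inter_right hM
  exact HasCompactSupport.intro' hK ((isClosed_tsupport F).preimage continuous_subtype_val) fun x hx => image_eq_zero_of_notMem_tsupport hx

/-- Two lcc functions vanishing on `M′` and agreeing on `M ∖ M′` have the same value under a functional killing the lcc functions vanishing on `M`.
[BernsteinZelevinsky1976, §1.5] -/
theorem apply_eq_of_agree_on_sdiff (M M' : Set X) (T : (X → ℂ) →ₗ[ℂ] ℂ)
    (hTM : ∀ F : X → ℂ, IsLocallyConstant F → HasCompactSupport F → (∀ x ∈ M, F x = 0) → T F = 0)
    {F F' : X → ℂ} (hF : IsLocallyConstant F) (hFs : HasCompactSupport F) (hF' : IsLocallyConstant F') (hF's : HasCompactSupport F')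
    (hF0 : ∀ x ∈ M', F x = 0) (hF'0 : ∀ x ∈ M', F' x = 0) (hagree : ∀ z : ↥(M \ M'), F z = F' z) : T F = T F' := by
  rw [← sub_eq_zero, ← map_sub]
  refine hTM _ (hF.comp₂ hF' fun a b => a - b) (hFs.sub hF's) fun x hx => ?_
  by_cases hxM' : x ∈ M'
  · rw [Pi.sub_apply, hF0 x hxM', hF'0 x hxM', sub_self]
  · rw [Pi.sub_apply, hagree ⟨x, hx, hxM'⟩, sub_self]

end Restrict

/-! ## §2  Descent to the test functions of the stratum -/

section Descend

variable {X : Type*} [TopologicalSpace X]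

/-- **DESCENT**: if `T` kills the lcc functions vanishing on `M` (`M` closed) and every lcc function on `M ∖ M′` extends to an lcc function vanishing on `M′`, there
is a linear functional `Td` on `M ∖ M′ → ℂ` with `Td (F|_{M∖M′}) = T F` for every lcc `F` vanishing on `M′`. [BernsteinZelevinsky1976, §1.5] -/
theorem exists_descend {M M' : Set X} (hM : IsClosed M) (T : (X → ℂ) →ₗ[ℂ] ℂ)
    (hTM : ∀ F : X → ℂ, IsLocallyConstant F → HasCompactSupport F → (∀ x ∈ M, F x = 0) → T F = 0)
    (hext : ∀ f : ↥(M \ M') → ℂ, IsLocallyConstant f → HasCompactSupport f →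
      ∃ F : X → ℂ, IsLocallyConstant F ∧ HasCompactSupport F ∧ (∀ x ∈ M', F x = 0) ∧ ∀ z : ↥(M \ M'), F z = f z) :
    ∃ Td : (↥(M \ M') → ℂ) →ₗ[ℂ] ℂ, ∀ F : X → ℂ, IsLocallyConstant F → HasCompactSupport F → (∀ x ∈ M', F x = 0) →
      Td (fun z => F z) = T F := by
  classical
  choose ext hext1 hext2 hext3 hext4 using hext
  have indep : ∀ {F F' : X → ℂ}, IsLocallyConstant F → HasCompactSupport F → IsLocallyConstant F' → HasCompactSupport F' →
      (∀ x ∈ M', F x = 0) → (∀ x ∈ M', F' x = 0) → (∀ z : ↥(M \ M'), F z = F' z) → T F = T F' :=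
    fun hF hFs hF' hF's hF0 hF'0 hag => apply_eq_of_agree_on_sdiff M M' T hTM hF hFs hF' hF's hF0 hF'0 hag
  -- the lcc submodule of the stratum and the functional on it
  let S : Submodule ℂ (↥(M \ M') → ℂ) :=
    { carrier := {f | IsLocallyConstant f ∧ HasCompactSupport f}
      add_mem' := fun {f g} hf hg => ⟨hf.1.comp₂ hg.1 fun a b => a + b, hf.2.add hg.2⟩
      zero_mem' := ⟨IsLocallyConstant.const 0, HasCompactSupport.zero⟩
      smul_mem' := fun c f hf => ⟨hf.1.comp fun z => c • z, hf.2.smul_left⟩ }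
  let t : S →ₗ[ℂ] ℂ :=
    { toFun := fun f => T (ext f.1 f.2.1 f.2.2)
      map_add' := fun f g => by
        show T (ext (f.1 + g.1) (S.add_mem f.2 g.2).1 (S.add_mem f.2 g.2).2) = T (ext f.1 f.2.1 f.2.2) + T (ext g.1 g.2.1 g.2.2)
        rw [← map_add]
        refine indep (hext1 _ _ _) (hext2 _ _ _) ((hext1 _ _ _).comp₂ (hext1 _ _ _) fun a b => a + b) ((hext2 _ _ _).add (hext2 _ _ _))
          (hext3 _ _ _) (fun x hx => by rw [Pi.add_apply, hext3 _ _ _ x hx, hext3 _ _ _ x hx, add_zero]) fun z => ?_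
        rw [hext4, Pi.add_apply, Pi.add_apply, hext4, hext4]
      map_smul' := fun c f => by
        show T (ext (c • f.1) (S.smul_mem c f.2).1 (S.smul_mem c f.2).2) = c • T (ext f.1 f.2.1 f.2.2)
        rw [← map_smul]
        refine indep (hext1 _ _ _) (hext2 _ _ _) ((hext1 _ _ _).comp fun z => c • z) (hext2 _ _ _).smul_left (hext3 _ _ _)
          (fun x hx => by rw [Pi.smul_apply, hext3 _ _ _ x hx, smul_zero]) fun z => ?_
        rw [hext4, Pi.smul_apply, Pi.smul_apply, hext4] }
  obtain ⟨Td, hTd⟩ := LinearMap.exists_extend t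
  refine ⟨Td, fun F hF hFs hF0 => ?_⟩
  have hres := lcc_restrict_sdiff hM hF hFs hF0
  have h1 : Td (fun z => F z) = t ⟨fun z => F z, hres⟩ := by
    rw [← hTd]; rfl
  rw [h1]
  show T (ext (fun z : ↥(M \ M') => F z) hres.1 hres.2) = T F
  exact indep (hext1 _ _ _) (hext2 _ _ _) hF hFs (hext3 _ _ _) hF0 fun z => hext4 _ _ _ z

variable {Γ : Type*} [Group Γ] [MulAction Γ X] [ContinuousConstSMul Γ X]

/-- **THE DESCENDED FUNCTIONAL IS SEMI-INVARIANT** for any self-map `act γ` of the stratum lifting the action (`(act γ z : X) = γ • z`), each `γ` acting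
continuously and `M′` being `Γ`-stable. [BernsteinZelevinsky1976, §1.18] -/
theorem descend_semiInvariant {M M' : Set X} (hM'Γ : ∀ γ : Γ, ∀ x ∈ M', γ • x ∈ M')
    (act : Γ → ↥(M \ M') → ↥(M \ M')) (hact : ∀ (γ : Γ) (z : ↥(M \ M')), ((act γ z : ↥(M \ M')) : X) = γ • (z : X))
    (hext : ∀ f : ↥(M \ M') → ℂ, IsLocallyConstant f → HasCompactSupport f →
      ∃ F : X → ℂ, IsLocallyConstant F ∧ HasCompactSupport F ∧ (∀ x ∈ M', F x = 0) ∧ ∀ z : ↥(M \ M'), F z = f z)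
    (χ : Γ →* ℂ) (T : (X → ℂ) →ₗ[ℂ] ℂ)
    (hT : ∀ F : X → ℂ, IsLocallyConstant F → HasCompactSupport F → (∀ x ∈ M', F x = 0) → ∀ γ : Γ, T (fun z => F (γ • z)) = χ γ * T F)
    (Td : (↥(M \ M') → ℂ) →ₗ[ℂ] ℂ)
    (hTd : ∀ F : X → ℂ, IsLocallyConstant F → HasCompactSupport F → (∀ x ∈ M', F x = 0) → Td (fun z => F z) = T F) :
    ∀ f : ↥(M \ M') → ℂ, IsLocallyConstant f → HasCompactSupport f → ∀ γ : Γ, Td (fun z => f (act γ z)) = χ γ * Td f := by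
  intro f hf hfs γ
  obtain ⟨F, hF, hFs, hF0, hFf⟩ := hext f hf hfs
  have hG : IsLocallyConstant fun z : X => F (γ • z) := hF.comp_continuous (continuous_const_smul γ)
  have hGs : HasCompactSupport fun z : X => F (γ • z) := hFs.comp_homeomorph (Homeomorph.smul γ)
  have hG0 : ∀ x ∈ M', F (γ • x) = 0 := fun x hx => hF0 _ (hM'Γ γ x hx)
  have hf' : (fun z : ↥(M \ M') => f (act γ z)) = fun z => F ((act γ z : ↥(M \ M')) : X) := funext fun z => (hFf _).symm
  have hf0 : f = fun z : ↥(M \ M') => F z := funext fun z => (hFf z).symm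
  rw [hf', hf0, hTd F hF hFs hF0]
  simp only [hact]
  rw [hTd _ hG hGs hG0, hT F hF hFs hF0 γ]

end Descend

/-! ## §3  One stratum: peeling by a wrong-character witness; proportionality on the line stratum -/

section Stratum

variable {Γ : Type*} [Group Γ] [TopologicalSpace Γ] [IsTopologicalGroup Γ] [TotallyDisconnectedSpace Γ] [SigmaCompactSpace Γ]
  {X : Type*} [TopologicalSpace X] [T2Space X] [LocallyCompactSpace X] [MulAction Γ X] [ContinuousSMul Γ X]

/-- **PEELING ONE STRATUM BY A WRONG-CHARACTER WITNESS.**  `M′ ⊆ M` closed `Γ`-stable, `M ∖ M′` one `Γ`-orbit with the extension property; a witness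
`x₀ ∈ M ∖ M′`, `γ₀ • x₀ = x₀`, `χ′` trivial on `K₀`, `χ γ₀ ≠ χ′ γ₀`, and a reference functional `T′`, `χ′`-semi-invariant on the lcc `F` vanishing on `M′`,
killing the lcc `F` vanishing on `M`, with `T′ F₁ ≠ 0` for one lcc `F₁` vanishing on `M′` (e.g. a relatively invariant measure on the stratum).  Then every
`χ`-semi-invariant `T` killing the lcc `F` vanishing on `M` kills the lcc `F` vanishing on `M′`. [Rallis1984; KudlaRallis1990, §2–3; KudlaSweet1997, §§2–4] -/
theorem kills_of_wrongChar_stratum (K₀ : Subgroup Γ) (hK₀o : IsOpen (K₀ : Set Γ)) (hK₀c : IsCompact (K₀ : Set Γ))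
    (χ : Γ →* ℂ) (hχ : ∀ k ∈ K₀, χ k = 1)
    (M M' : Set X) (hM : IsClosed M) (hM' : IsClosed M') (hMΓ : ∀ γ : Γ, ∀ x ∈ M, γ • x ∈ M) (hM'Γ : ∀ γ : Γ, ∀ x ∈ M', γ • x ∈ M')
    (htrans : ∀ x ∈ M \ M', ∀ y ∈ M \ M', ∃ γ : Γ, γ • x = y)
    (hext : ∀ f : ↥(M \ M') → ℂ, IsLocallyConstant f → HasCompactSupport f →
      ∃ F : X → ℂ, IsLocallyConstant F ∧ HasCompactSupport F ∧ (∀ x ∈ M', F x = 0) ∧ ∀ z : ↥(M \ M'), F z = f z)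
    (x₀ : X) (hx₀ : x₀ ∈ M \ M') (γ₀ : Γ) (hγ₀ : γ₀ • x₀ = x₀) (χ' : Γ →* ℂ) (hχ' : ∀ k ∈ K₀, χ' k = 1) (hχγ : χ γ₀ ≠ χ' γ₀)
    (T' : (X → ℂ) →ₗ[ℂ] ℂ)
    (hT' : ∀ F : X → ℂ, IsLocallyConstant F → HasCompactSupport F → (∀ x ∈ M', F x = 0) → ∀ γ : Γ, T' (fun z => F (γ • z)) = χ' γ * T' F)
    (hT'M : ∀ F : X → ℂ, IsLocallyConstant F → HasCompactSupport F → (∀ x ∈ M, F x = 0) → T' F = 0)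
    (hT'ne : ∃ F₁ : X → ℂ, IsLocallyConstant F₁ ∧ HasCompactSupport F₁ ∧ (∀ x ∈ M', F₁ x = 0) ∧ T' F₁ ≠ 0)
    (T : (X → ℂ) →ₗ[ℂ] ℂ)
    (hT : ∀ F : X → ℂ, IsLocallyConstant F → HasCompactSupport F → (∀ x ∈ M', F x = 0) → ∀ γ : Γ, T (fun z => F (γ • z)) = χ γ * T F)
    (hTM : ∀ F : X → ℂ, IsLocallyConstant F → HasCompactSupport F → (∀ x ∈ M, F x = 0) → T F = 0)
    {F : X → ℂ} (hF : IsLocallyConstant F) (hFs : HasCompactSupport F) (hF0 : ∀ x ∈ M', F x = 0) : T F = 0 := by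
  classical
  -- the stratum as a `Γ`-space
  have hstab : ∀ (γ : Γ) (z : ↥(M \ M')), γ • (z : X) ∈ M \ M' := fun γ z =>
    ⟨hMΓ γ z z.2.1, fun h => z.2.2 (by rw [← inv_smul_smul γ (z : X)]; exact hM'Γ γ⁻¹ _ h)⟩
  letI : MulAction Γ ↥(M \ M') :=
    { smul := fun γ z => ⟨γ • (z : X), hstab γ z⟩
      one_smul := fun z => Subtype.ext (one_smul Γ (z : X))
      mul_smul := fun a b z => Subtype.ext (mul_smul a b (z : X)) }
  have hcoe : ∀ (γ : Γ) (z : ↥(M \ M')), (((γ • z : ↥(M \ M')) : X)) = γ • (z : X) := fun _ _ => rfl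
  haveI : ContinuousSMul Γ ↥(M \ M') :=
    ⟨(continuous_smul.comp (continuous_fst.prodMk (continuous_subtype_val.comp continuous_snd))).subtype_mk _⟩
  haveI : LocallyCompactSpace ↥(M \ M') := (hM.isLocallyClosed.inter hM'.isOpen_compl.isLocallyClosed).locallyCompactSpace
  haveI : IsPretransitive Γ ↥(M \ M') :=
    ⟨fun z y => by obtain ⟨γ, hγ⟩ := htrans z z.2 y y.2; exact ⟨γ, Subtype.ext hγ⟩⟩
  have hopen : ∀ z : ↥(M \ M'), IsOpenMap fun γ : Γ => γ • z := fun z => isOpenMap_smul_of_sigmaCompact z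
  -- descend `T` and `T′`
  obtain ⟨Td, hTd⟩ := exists_descend hM T hTM hext
  obtain ⟨Td', hTd'⟩ := exists_descend hM T' hT'M hext
  have hsT := descend_semiInvariant hM'Γ (fun γ z => γ • z) hcoe hext χ T hT Td hTd
  have hsT' := descend_semiInvariant hM'Γ (fun γ z => γ • z) hcoe hext χ' T' hT' Td' hTd'
  -- the witness on the orbit: `Td′(1_{K₀•z₀}) ≠ 0`, `γ₀ • z₀ = z₀`
  set z₀ : ↥(M \ M') := ⟨x₀, hx₀⟩ with hz₀
  have hγz₀ : γ₀ • z₀ = z₀ := Subtype.ext hγ₀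
  have hne' : Td' ((orbit K₀ z₀).indicator fun _ => (1 : ℂ)) ≠ 0 := by
    intro h0
    obtain ⟨F₁, hF₁, hF₁s, hF₁0, hF₁ne⟩ := hT'ne
    have hres := lcc_restrict_sdiff hM hF₁ hF₁s hF₁0
    have h := eq_zero_of_apply_base_eq_zero K₀ hK₀o hK₀c hopen χ' hχ' z₀ Td' hsT' h0 hres.1 hres.2
    rw [hTd' F₁ hF₁ hF₁s hF₁0] at h
    exact hF₁ne h
  -- ★ V4b at the base cell, then ★ V4 on the orbit
  have hbase : Td ((orbit K₀ z₀).indicator fun _ => (1 : ℂ)) = 0 :=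
    apply_base_eq_zero_of_char_ne K₀ hK₀o hK₀c hopen hγz₀ χ χ' hχ hχ' Td Td' hsT hsT' hne' hχγ
  have hres := lcc_restrict_sdiff hM hF hFs hF0
  rw [← hTd F hF hFs hF0]
  exact eq_zero_of_apply_base_eq_zero K₀ hK₀o hK₀c hopen χ hχ z₀ Td hsT hbase hres.1 hres.2

/-- **PROPORTIONALITY ON THE LINE STRATUM.**  Same geometry, no witness: if `T₁, T₂` are `χ`-semi-invariant on the lcc `F` vanishing on `M′`, kill the lcc `F`
vanishing on `M`, and `T₁ F₁ ≠ 0` for one lcc `F₁` vanishing on `M′`, then `T₂ = c · T₁` on the lcc `F` vanishing on `M′`.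
[BernsteinZelevinsky1976, §1.18; KudlaRallis1990, §2–3; KudlaSweet1997, §§2–4] -/
theorem exists_const_of_line_stratum (K₀ : Subgroup Γ) (hK₀o : IsOpen (K₀ : Set Γ)) (hK₀c : IsCompact (K₀ : Set Γ))
    (χ : Γ →* ℂ) (hχ : ∀ k ∈ K₀, χ k = 1)
    (M M' : Set X) (hM : IsClosed M) (hM' : IsClosed M') (hMΓ : ∀ γ : Γ, ∀ x ∈ M, γ • x ∈ M) (hM'Γ : ∀ γ : Γ, ∀ x ∈ M', γ • x ∈ M')
    (htrans : ∀ x ∈ M \ M', ∀ y ∈ M \ M', ∃ γ : Γ, γ • x = y)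
    (hext : ∀ f : ↥(M \ M') → ℂ, IsLocallyConstant f → HasCompactSupport f →
      ∃ F : X → ℂ, IsLocallyConstant F ∧ HasCompactSupport F ∧ (∀ x ∈ M', F x = 0) ∧ ∀ z : ↥(M \ M'), F z = f z)
    (T₁ T₂ : (X → ℂ) →ₗ[ℂ] ℂ)
    (hT₁ : ∀ F : X → ℂ, IsLocallyConstant F → HasCompactSupport F → (∀ x ∈ M', F x = 0) → ∀ γ : Γ, T₁ (fun z => F (γ • z)) = χ γ * T₁ F)
    (hT₂ : ∀ F : X → ℂ, IsLocallyConstant F → HasCompactSupport F → (∀ x ∈ M', F x = 0) → ∀ γ : Γ, T₂ (fun z => F (γ • z)) = χ γ * T₂ F)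
    (hT₁M : ∀ F : X → ℂ, IsLocallyConstant F → HasCompactSupport F → (∀ x ∈ M, F x = 0) → T₁ F = 0)
    (hT₂M : ∀ F : X → ℂ, IsLocallyConstant F → HasCompactSupport F → (∀ x ∈ M, F x = 0) → T₂ F = 0)
    (hne : ∃ F₁ : X → ℂ, IsLocallyConstant F₁ ∧ HasCompactSupport F₁ ∧ (∀ x ∈ M', F₁ x = 0) ∧ T₁ F₁ ≠ 0) :
    ∃ c : ℂ, ∀ F : X → ℂ, IsLocallyConstant F → HasCompactSupport F → (∀ x ∈ M', F x = 0) → T₂ F = c * T₁ F := by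
  classical
  have hstab : ∀ (γ : Γ) (z : ↥(M \ M')), γ • (z : X) ∈ M \ M' := fun γ z =>
    ⟨hMΓ γ z z.2.1, fun h => z.2.2 (by rw [← inv_smul_smul γ (z : X)]; exact hM'Γ γ⁻¹ _ h)⟩
  letI : MulAction Γ ↥(M \ M') :=
    { smul := fun γ z => ⟨γ • (z : X), hstab γ z⟩
      one_smul := fun z => Subtype.ext (one_smul Γ (z : X))
      mul_smul := fun a b z => Subtype.ext (mul_smul a b (z : X)) }
  have hcoe : ∀ (γ : Γ) (z : ↥(M \ M')), (((γ • z : ↥(M \ M')) : X)) = γ • (z : X) := fun _ _ => rfl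
  haveI : ContinuousSMul Γ ↥(M \ M') :=
    ⟨(continuous_smul.comp (continuous_fst.prodMk (continuous_subtype_val.comp continuous_snd))).subtype_mk _⟩
  haveI : LocallyCompactSpace ↥(M \ M') := (hM.isLocallyClosed.inter hM'.isOpen_compl.isLocallyClosed).locallyCompactSpace
  haveI : IsPretransitive Γ ↥(M \ M') :=
    ⟨fun z y => by obtain ⟨γ, hγ⟩ := htrans z z.2 y y.2; exact ⟨γ, Subtype.ext hγ⟩⟩
  have hopen : ∀ z : ↥(M \ M'), IsOpenMap fun γ : Γ => γ • z := fun z => isOpenMap_smul_of_sigmaCompact z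
  obtain ⟨Td₁, hTd₁⟩ := exists_descend hM T₁ hT₁M hext
  obtain ⟨Td₂, hTd₂⟩ := exists_descend hM T₂ hT₂M hext
  have hs₁ := descend_semiInvariant hM'Γ (fun γ z => γ • z) hcoe hext χ T₁ hT₁ Td₁ hTd₁
  have hs₂ := descend_semiInvariant hM'Γ (fun γ z => γ • z) hcoe hext χ T₂ hT₂ Td₂ hTd₂
  obtain ⟨F₁, hF₁, hF₁s, hF₁0, hF₁ne⟩ := hne
  have hres₁ := lcc_restrict_sdiff hM hF₁ hF₁s hF₁0
  have hne₁ : Td₁ (fun z : ↥(M \ M') => F₁ z) ≠ 0 := by rw [hTd₁ F₁ hF₁ hF₁s hF₁0]; exact hF₁ne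
  obtain ⟨c, hc⟩ := exists_forall_apply_eq_const_mul K₀ hK₀o hK₀c hopen χ hχ Td₁ Td₂ hs₁ hs₂ hres₁.1 hres₁.2 hne₁
  refine ⟨c, fun F hF hFs hF0 => ?_⟩
  have hres := lcc_restrict_sdiff hM hF hFs hF0
  rw [← hTd₁ F hF hFs hF0, ← hTd₂ F hF hFs hF0]
  exact hc _ hres.1 hres.2

end Stratum

end Summit.HodgeConjecture.HodgeConjecture.Cruxes.HLiu418.K2LiuNullConeStratumPeeling

end
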